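import Summits.ValiantsHypothesis.ValiantsHypothesis.Theorems.MonotoneRestorationOrbitRestorationQPValueSupport
import Literature.Computability.AlgebraicComplexity.SymmetricCircuitRigidity
import HarnessLib

/-!
# Factors of a symmetric product of affine forms are rigidly supported (ORBIT currency, XIV)

Route MonotoneRestoration, crux `OrbitRestorationQP` (stmt-ValiantsHypothesis-18293), namespace
`Summit.ValiantsHypothesis.ValiantsHypothesis.Theorems.AffineFactors`.  Route-independent (no `Theses` import).

The structural half of the `k = 1` sub-rung (ΠΣ: products of polynomially many affine forms) of the first rung
`SigmaPiSigmaRestorationQP` of line `depth-three-rung`, by the SUPPORT THEOREM route.  Let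
`f = a · Π L` be a product of affine forms (total degree `≤ 1`, `|L| < C(n,k)`, `n > 8`, `4k ≤ n`), `f ≠ 0`,
invariant under the diagonal action of `Sym(Fin n)`.  Then EVERY FACTOR `ℓ ∈ L` is fixed by the pointwise
stabiliser of fewer than `k` indices (`exists_support_of_mem_factors`) — so its orbit is polynomial, although
the multiset `L` itself need not be stable (the factors are permuted only up to units: sign characters).

Chain: `ren σ ℓ` is irreducible of degree `1`, hence prime (`K[x]` is factorial), divides `f`, so is a unit
multiple of a member of `L` (`exists_assoc_mem_of_ren`) ⇒ the stabiliser of the LINE `[ℓ]` has index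
`≤ |L| < C(n,k)` (coset `↦` factor is injective) ⇒ Dixon–Mortimer 5.2B gives an alternating support of the
line ⇒ the line is fixed exactly (`ValueSupport.fixes_of_fixesLine`, `A_m` perfect) ⇒ affine upgrade
(`ValueSupport.symFixes_of_altFixes_affine`).

Everything is proved. [folklore]

## References
* J. D. Dixon, B. Mortimer, *Permutation Groups*, GTM 163 (1996), Thm 5.2B. [DixonMortimer1996]
* A. Dawar, G. Wilsenach, *Symmetric arithmetic circuits*, ToC 21 (2025), Def. 6.1, §6. [DawarWilsenach2025]
-/

noncomputable section

open scoped Classical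

-- `Summit.ValiantsHypothesis.ValiantsHypothesis.…` is the tree's single-conjunct layout (Sub = Summit).
set_option linter.dupNamespace false

namespace Summit.ValiantsHypothesis.ValiantsHypothesis.Theorems

namespace AffineFactors

open Equiv Literature.GroupTheory.PermutationGroups

variable {n : ℕ}

/-! ### Degree-one polynomials -/

/-- Renaming by a permutation preserves the total degree. [folklore] -/
theorem totalDegree_ren (σ : Perm (Fin n)) (q : MvPolynomial (Fin n × Fin n) ℂ) :
    (ren σ q).totalDegree = q.totalDegree := by
  refine le_antisymm (MvPolynomial.totalDegree_rename_le _ _) ?_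
  conv_lhs => rw [← ren_inv_ren σ q]
  exact MvPolynomial.totalDegree_rename_le _ _

/-- Over a field, a polynomial of total degree `1` is irreducible (Mathlib
`MvPolynomial.irreducible_of_totalDegree_eq_one`). [folklore] -/
theorem irreducible_of_totalDegree_eq_one {q : MvPolynomial (Fin n × Fin n) ℂ} (hq : q.totalDegree = 1) :
    Irreducible q := by
  refine MvPolynomial.irreducible_of_totalDegree_eq_one hq fun x hx => ?_
  by_cases hx0 : x = 0
  · subst hx0
    have hq0 : q = 0 := MvPolynomial.ext _ _ fun i => by simpa using hx i
    rw [hq0, MvPolynomial.totalDegree_zero] at hq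
    exact absurd hq zero_ne_one
  · exact isUnit_iff_ne_zero.2 hx0

/-- A nonzero constant times a product is nonzero only if every factor is nonzero. [folklore] -/
theorem ne_zero_of_mem {L : Multiset (MvPolynomial (Fin n × Fin n) ℂ)} {a : ℂ}
    (hf0 : MvPolynomial.C a * L.prod ≠ 0) {ℓ : MvPolynomial (Fin n × Fin n) ℂ} (hℓ : ℓ ∈ L) : ℓ ≠ 0 := by
  rintro rfl
  exact hf0 (by rw [Multiset.prod_eq_zero hℓ, mul_zero])

/-! ### The translates of a factor are unit multiples of factors -/

/-- **Translates of a factor are associates of factors.**  If `f = a · Π L` (affine factors) is nonzero and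
diagonally invariant, then for every factor `ℓ` of degree `1` and every `σ`, `ren σ ℓ = u · ℓ'` for some
factor `ℓ' ∈ L` and unit `u` (unique factorisation in `ℂ[x_ij]`). [folklore] -/
theorem exists_assoc_mem_of_ren {L : Multiset (MvPolynomial (Fin n × Fin n) ℂ)} {a : ℂ}
    (hL : ∀ ℓ ∈ L, ℓ.totalDegree ≤ 1) (hf0 : MvPolynomial.C a * L.prod ≠ 0)
    (hfix : ∀ σ : Perm (Fin n), ren σ (MvPolynomial.C a * L.prod) = MvPolynomial.C a * L.prod)
    {ℓ : MvPolynomial (Fin n × Fin n) ℂ} (hℓ : ℓ ∈ L) (hdeg : ℓ.totalDegree = 1) (σ : Perm (Fin n)) :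
    ∃ ℓ' ∈ L, ∃ u : ℂ, u ≠ 0 ∧ ren σ ℓ = MvPolynomial.C u * ℓ' := by
  set p := ren σ ℓ with hp
  have hpdeg : p.totalDegree = 1 := by rw [hp, totalDegree_ren, hdeg]
  have hprime : Prime p :=
    UniqueFactorizationMonoid.irreducible_iff_prime.1 (irreducible_of_totalDegree_eq_one hpdeg)
  have ha : a ≠ 0 := by rintro rfl; exact hf0 (by rw [map_zero, zero_mul])
  -- `p ∣ a · Π L`
  have hdvd : p ∣ MvPolynomial.C a * L.prod := by
    have h1 : p ∣ ren σ L.prod := by rw [hp]; exact map_dvd (ren σ) (Multiset.dvd_prod hℓ)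
    have h2 : ren σ L.prod ∣ ren σ (MvPolynomial.C a * L.prod) := by
      rw [map_mul, ren_C]; exact dvd_mul_left _ _
    rw [← hfix σ]; exact h1.trans h2
  rcases hprime.dvd_or_dvd hdvd with h | h
  · -- a prime does not divide a unit
    exact absurd (isUnit_of_dvd_unit h ((isUnit_iff_ne_zero.2 ha).map MvPolynomial.C)) hprime.not_unit
  · obtain ⟨ℓ', hℓ', r, hr⟩ := hprime.exists_mem_multiset_dvd h
    have hℓ'0 : ℓ' ≠ 0 := ne_zero_of_mem hf0 hℓ'
    have hp0 : p ≠ 0 := hprime.ne_zero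
    have hr0 : r ≠ 0 := by rintro rfl; exact hℓ'0 (by rw [hr, mul_zero])
    have hdr : r.totalDegree = 0 := by
      have := MvPolynomial.totalDegree_mul_of_isDomain hp0 hr0
      rw [← hr, hpdeg] at this
      have := hL ℓ' hℓ'
      omega
    obtain ⟨u, hu⟩ : ∃ u : ℂ, r = MvPolynomial.C u := ⟨_, MvPolynomial.totalDegree_eq_zero_iff_eq_C.1 hdr⟩
    have hu0 : u ≠ 0 := by rintro rfl; exact hr0 (by rw [hu, map_zero])
    refine ⟨ℓ', hℓ', u⁻¹, inv_ne_zero hu0, ?_⟩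
    rw [hr, hu, mul_comm p, ← mul_assoc, ← map_mul, inv_mul_cancel₀ hu0, map_one, one_mul]

/-! ### The support of a factor -/

/-- **FACTORS OF A SYMMETRIC AFFINE PRODUCT ARE RIGIDLY SUPPORTED.**  Let `n > 8`, `1 ≤ k`, `4k ≤ n`, and
let `f = a · Π L` be a nonzero product of fewer than `C(n,k)` polynomials of total degree `≤ 1` that is
invariant under the diagonal action of `Sym(Fin n)`.  Then every factor `ℓ ∈ L` is fixed by the pointwise
stabiliser of a set of fewer than `k` indices (Dawar–Wilsenach's supports, Def. 6.1); by
`ValueOrbit.orbit_bounded_of_supported` its orbit has at most `(n+1)^(k-1)` elements.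
[folklore; cite: DawarWilsenach2025, Def. 6.1 and §6; DixonMortimer1996, Thm 5.2B] -/
theorem exists_support_of_mem_factors {k : ℕ} (hn : 8 < n) (hk : 1 ≤ k) (h4k : 4 * k ≤ n)
    {L : Multiset (MvPolynomial (Fin n × Fin n) ℂ)} {a : ℂ}
    (hL : ∀ ℓ ∈ L, ℓ.totalDegree ≤ 1) (hcard : Multiset.card L < n.choose k)
    (hf0 : MvPolynomial.C a * L.prod ≠ 0)
    (hfix : ∀ σ : Perm (Fin n), ren σ (MvPolynomial.C a * L.prod) = MvPolynomial.C a * L.prod)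
    {ℓ : MvPolynomial (Fin n × Fin n) ℂ} (hℓ : ℓ ∈ L) :
    ∃ X : Finset (Fin n), X.card < k ∧ ∀ ρ : Perm (Fin n), (∀ x ∈ X, ρ x = x) → ren ρ ℓ = ℓ := by
  rcases Nat.lt_or_ge ℓ.totalDegree 1 with h0 | h1
  · -- a constant factor
    refine ⟨∅, by rw [Finset.card_empty]; omega, fun ρ _ => ?_⟩
    have h00 : ℓ.totalDegree = 0 := by omega
    rw [(MvPolynomial.totalDegree_eq_zero_iff_eq_C (p := ℓ)).1 h00, ren_C]
  · have hdeg : ℓ.totalDegree = 1 := le_antisymm (hL ℓ hℓ) h1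
    have hℓ0 : ℓ ≠ 0 := ne_zero_of_mem hf0 hℓ
    -- the stabiliser of the LINE of `ℓ`: permutations mapping `ℓ` to a nonzero scalar multiple of itself
    let S : Subgroup (Perm (Fin n)) :=
      { carrier := {ρ | ∃ u : ℂ, u ≠ 0 ∧ ren ρ ℓ = MvPolynomial.C u * ℓ}
        mul_mem' := by
          rintro a b ⟨u, hu0, hu⟩ ⟨v, hv0, hv⟩
          refine ⟨u * v, mul_ne_zero hu0 hv0, ?_⟩
          rw [ren_mul, hv, map_mul, ren_C, hu, map_mul]; ring
        one_mem' := ⟨1, one_ne_zero, by rw [ren_one, map_one, one_mul]⟩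
        inv_mem' := by
          rintro a ⟨u, hu0, hu⟩
          refine ⟨u⁻¹, inv_ne_zero hu0, ?_⟩
          have h := congrArg (ren a⁻¹) hu
          rw [ren_inv_ren, map_mul, ren_C] at h
          calc ren a⁻¹ ℓ = MvPolynomial.C u⁻¹ * (MvPolynomial.C u * ren a⁻¹ ℓ) := by
                rw [← mul_assoc, ← map_mul, inv_mul_cancel₀ hu0, map_one, one_mul]
            _ = MvPolynomial.C u⁻¹ * ℓ := by rw [← h] }
    have hS : ∀ ρ : Perm (Fin n), ρ ∈ S ↔ ∃ u : ℂ, u ≠ 0 ∧ ren ρ ℓ = MvPolynomial.C u * ℓ := fun ρ => Iff.rfl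
    -- its index is at most the number of distinct factors
    have hindex : S.index ≤ Multiset.card L := by
      choose m hm u hu0 hu using fun σ : Perm (Fin n) => exists_assoc_mem_of_ren hL hf0 hfix hℓ hdeg σ
      let f : Perm (Fin n) ⧸ S → L.toFinset := fun c => ⟨m c.out, Multiset.mem_toFinset.2 (hm c.out)⟩
      have hf : Function.Injective f := by
        intro c d hcd
        have hmm : m c.out = m d.out := congrArg Subtype.val hcd
        rw [← QuotientGroup.out_eq' c, ← QuotientGroup.out_eq' d, QuotientGroup.eq, hS]
        refine ⟨(u c.out)⁻¹ * u d.out, mul_ne_zero (inv_ne_zero (hu0 _)) (hu0 _), ?_⟩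
        have h1 : ren c.out⁻¹ (m c.out) = MvPolynomial.C (u c.out)⁻¹ * ℓ := by
          have h := congrArg (ren c.out⁻¹) (hu c.out)
          rw [ren_inv_ren, map_mul, ren_C] at h
          calc ren c.out⁻¹ (m c.out)
              = MvPolynomial.C (u c.out)⁻¹ * (MvPolynomial.C (u c.out) * ren c.out⁻¹ (m c.out)) := by
                rw [← mul_assoc, ← map_mul, inv_mul_cancel₀ (hu0 _), map_one, one_mul]
            _ = MvPolynomial.C (u c.out)⁻¹ * ℓ := by rw [← h]
        rw [ren_mul, hu d.out, map_mul, ren_C, ← hmm, h1, map_mul]; ring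
      have h := Nat.card_le_card_of_injective f hf
      rw [Nat.card_eq_finsetCard] at h
      exact h.trans (Multiset.toFinset_card_le L)
    have hidx : S.index < (Fintype.card (Fin n)).choose k := by
      rw [Fintype.card_fin]; exact hindex.trans_lt hcard
    -- Dixon–Mortimer 5.2B: an alternating support of the line
    obtain ⟨X, hXk, hX⟩ := alternating_fixing_le_of_index_lt_choose S k
      (by rwa [Fintype.card_fin]) hk (by rwa [Fintype.card_fin]) hidx
    have hline : ∀ ρ : Perm (Fin n), (∀ x ∈ X, ρ x = x) → Perm.sign ρ = 1 →
        ∃ u : ℂ, ren ρ ℓ = MvPolynomial.C u * ℓ := fun ρ hρ hs => by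
      obtain ⟨u, -, hu⟩ := (hS ρ).1 (hX ρ hρ hs)
      exact ⟨u, hu⟩
    -- the line is fixed exactly (perfectness), then the affine upgrade
    have halt := ValueSupport.fixes_of_fixesLine (X := X) (by omega) hℓ0 hline
    exact ⟨X, hXk, ValueSupport.symFixes_of_altFixes_affine (by omega) (hL ℓ hℓ) halt⟩

/-- **Polynomial orbits of the factors** (the support bound made explicit): under the hypotheses of
`exists_support_of_mem_factors`, every factor has at most `n^(k-1)` diagonal translates.
[folklore; cite: DawarWilsenach2025, Def. 6.1] -/
theorem ncard_orbit_factor_le {k : ℕ} (hn : 8 < n) (hk : 1 ≤ k) (h4k : 4 * k ≤ n)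
    {L : Multiset (MvPolynomial (Fin n × Fin n) ℂ)} {a : ℂ}
    (hL : ∀ ℓ ∈ L, ℓ.totalDegree ≤ 1) (hcard : Multiset.card L < n.choose k)
    (hf0 : MvPolynomial.C a * L.prod ≠ 0)
    (hfix : ∀ σ : Perm (Fin n), ren σ (MvPolynomial.C a * L.prod) = MvPolynomial.C a * L.prod)
    {ℓ : MvPolynomial (Fin n × Fin n) ℂ} (hℓ : ℓ ∈ L) :
    (Set.range fun σ : Perm (Fin n) => ren σ ℓ).ncard ≤ n ^ (k - 1) := by
  obtain ⟨X, hXk, hX⟩ := exists_support_of_mem_factors hn hk h4k hL hcard hf0 hfix hℓ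
  have hagree : ∀ σ τ : Perm (Fin n), (∀ i ∈ X, σ i = τ i) → ren σ ℓ = ren τ ℓ := by
    intro σ τ hστ
    have hfix' : ren (τ⁻¹ * σ) ℓ = ℓ := hX (τ⁻¹ * σ) fun i hi => by
      rw [Perm.mul_apply, hστ i hi]
      exact τ.symm_apply_apply i
    have := congrArg (ren τ) hfix'
    rwa [← ren_mul, mul_inv_cancel_left] at this
  refine (Literature.Computability.AlgebraicComplexity.ncard_range_le_pow_of_agree X
    (fun σ : Perm (Fin n) => ren σ ℓ) hagree).trans ?_
  rw [Fintype.card_fin]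
  exact Nat.pow_le_pow_right (by omega) (by omega)

end AffineFactors

end Summit.ValiantsHypothesis.ValiantsHypothesis.Theorems

end
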